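import Literature.NumberTheory.Automorphic.OrbitalMeasureCanonical
import Literature.LinearAlgebra.Matrix.NonderogatoryCommutantBaseChange
import Mathlib.FieldTheory.SplittingField.Construction
import Mathlib.LinearAlgebra.Lagrange
import Mathlib.Analysis.Normed.Unbundled.SpectralNorm
import Mathlib.Topology.Algebra.Module.FiniteDimension
import HarnessLib

/-!
# The compact core of the centraliser of a regular semisimple element of `GL_N` over a complete non-archimedean field is bounded
(Tits, *Reductive groups over local fields* (1979), §3.9 «the maximal compact subgroup of `T(k)`»; Platonov–Rapinchuk (1994), §3.3;
Bosch–Güntzer–Remmert (1984), 3.1.2∕1 (roots are bounded by the spectral value); Horn–Johnson (2013), Thm. 3.2.4.2; Rogawski (1990), §4.3 p. 43)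

Topic `NumberTheory/Automorphic`; namespace `Literature.NumberTheory.Automorphic`.  THEOREMS ONLY (no definition, no instance, no notation, no named fact, no
`sorry`).  Cell `pub/hodgecm-mathlib`, P3a road D-N6s gap **g0** (LEAD F0P3a-plan (g8) T7-5 (1) 2026-09-01; A-p03 (g23)), FILE A of two (FILE B =
`CompactCoreCentralizerNonarch`: the generic «compact core of a commutative group is an open subgroup» layer, the instantiation at `E_w`, the dockings).  ★ `OrbitalMeasureCanonical` normalises the torus measures of a CANONICAL orbital-measure
family by «mass one on `compactCore G_γ`» (:134) and says (docstring) that this wants `compactCore G_γ` COMPACT OPEN at every finite place; ★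
`CanonicalTorusMeasureTransport.map_eq_of_apply_compactCore_eq_one` takes `IsCompact (compactCore Z′)` ∕ `IsOpen (compactCore Z′)` as HYPOTHESES; the tree
proved them only at the places of GOOD REDUCTION of a RATIONAL `γ` (★ `CompactCoreCentralizerLevelOfIntegralConjugacy`).  This file removes the restriction:

* §1 COORDINATES (`F` a field, `γ ∈ M_N(F)` with SEPARABLE characteristic polynomial — regular semisimple): every matrix commuting with `γ` is
  `∑_{i<N} c_i γ^i` (★ `exists_eq_aeval_map_of_commute_of_charpoly_separable`) with UNIQUE `c` (★ `minpoly = charpoly` has degree `N`), and at every root `t`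
  of `χ_γ` in an extension field the «eigen-coordinate» `c ↦ ∑ c_i tⁱ` is multiplicative on such matrices (`aeval_root_eq_mul_of_sum_smul_pow_mul`, via
  `χ_γ ∣ P_c P_d − P_e`), so the eigen-coordinate of `x^{n+1}` is the `(n+1)`-st power of that of `x` (`aeval_root_pow_succ`).
* §2 THE BOUND (`F` a complete non-trivially normed ULTRAMETRIC field): **`exists_forall_norm_coord_le`** — there is `R = R(γ) ≥ 0` such that for EVERY compact,
  multiplicatively closed set `S` of matrices commuting with `γ`, every `x = ∑ c_i γ^i ∈ S` has `‖c_i‖ ≤ R`.  Proof: the coordinate map is a closed embedding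
  (Mathlib `LinearMap.isClosedEmbedding_of_injective`), so the coordinates of `S` are bounded; the powers `x^{n+1}` stay in `S`; in the splitting field `L` of
  `χ_γ` with Mathlib's `spectralNorm F L` (extends `‖·‖`, sub- and power-multiplicative, non-archimedean) the eigen-coordinate `a_t(x)` at each of the `N`
  distinct roots satisfies `spectralNorm (a_t(x))^{n+1} ≤ M` for all `n`, hence `spectralNorm (a_t(x)) ≤ 1` [BoschGuntzerRemmert1984 3.1.2∕1 in spirit]; LAGRANGE
  interpolation at the `N` roots (Mathlib `Lagrange.eq_interpolate`) writes `c_j` as `∑_t a_t(x) · coeff_j(ℓ_t)`, whence `‖c_j‖ ≤ R := ∑_t ∑_j spectralNorm (coeff_j ℓ_t)`.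
  (Separability is load-bearing: with `ε² = 0` the elements `1 + λε` are power-bounded for all `|λ| ≤ 1`-multiples yet unbounded in `λ` over a
  non-archimedean field — the compact core of a non-semisimple centraliser is NOT compact.)
* §3 `GL_N(F)` (`F` moreover proper, e.g. locally compact): **`exists_isCompact_forall_mem_compactCore_centralizer`** (one compact set of matrices containing
  `↑z` for every `z ∈ compactCore Z_{GL_N(F)}(γ)`) and **`isCompact_compactCore_centralizer_of_isClosed`** (compactness of `compactCore Z(γ)` once it is closed —
  FILE B gives closedness from the compact open subgroup `Z(γ) ∩ GL_N(𝒪_w)` at `F = E_w`, commutativity of `Z(γ)`).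
HONEST LABEL: elementary structure theory («`T(F)` has a unique maximal compact subgroup, open», [Tits1979 §3.9], [PlatonovRapinchuk1994 §3.3]); HC_CM is
proved only modulo the printed citations until rung 0 closes, and this file moves no count.

## Mathlib ∕ tree search
Tree: ★ `OrbitalMeasureCanonical` (`compactCore`, `mem_compactCore_iff`), ★ `NonderogatoryCommutantBaseChange` (`exists_eq_aeval_map_of_commute_of_charpoly_separable`,
`minpoly_eq_charpoly_of_charpoly_separable`), ★ `CompactCoreCentralizerLevelOfIntegralConjugacy` (the good-reduction case, docked in FILE B).  Mathlib: `spectralNorm` (`spectralNorm_extends`, `spectralNorm_mul`, `isPowMul_spectralNorm`,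
`isNonarchimedean_spectralNorm`), `Polynomial.SplittingField`, `nodup_roots`, `Splits.natDegree_eq_card_roots`, `Lagrange.eq_interpolate`, `Lagrange.basis`,
`LinearMap.isClosedEmbedding_of_injective`, `Units.isClosedEmbedding_embedProduct`.
Dedup: `rg "isCompact_compactCore|isOpen_compactCore|mul_mem_compactCore" Literature/` — no hits.

## References
* [Tits1979] J. Tits, *Reductive groups over local fields*, Proc. Sympos. Pure Math. 33.1 (1979), §3.9.
* [PlatonovRapinchuk1994] V. Platonov, A. Rapinchuk, *Algebraic Groups and Number Theory* (1994), §3.3.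
* [BoschGuntzerRemmert1984] S. Bosch, U. Güntzer, R. Remmert, *Non-Archimedean Analysis* (1984), 3.1.2∕1.
* [HornJohnson2013] R. A. Horn, C. R. Johnson, *Matrix Analysis*, 2nd ed. (2013), Thm. 3.2.4.2.
* [Rogawski1990] J. D. Rogawski, *Automorphic Representations of Unitary Groups in Three Variables* (1990), §4.3 p. 43.
-/

set_option autoImplicit false

noncomputable section

open Set Filter Topology Polynomial
open scoped Pointwise Matrix MatrixGroups

namespace Literature.NumberTheory.Automorphic

/-! ## §1 Coordinates of the commutant of a regular semisimple matrix, and the eigen-coordinates at the roots -/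

section CoordAlgebra

variable {F : Type*} [Field F] {N : ℕ} (γ : Matrix (Fin N) (Fin N) F)

/-- `aeval a (∑ C (c i) X^i) = ∑ c i • a^i`. [cite: HornJohnson2013, Thm. 3.2.4.2] -/
theorem aeval_sum_C_mul_X_pow {A : Type*} [Ring A] [Algebra F A] (a : A) (c : Fin N → F) :
    aeval a (∑ i : Fin N, C (c i) * X ^ (i : ℕ)) = ∑ i : Fin N, c i • a ^ (i : ℕ) := by
  rw [map_sum]
  refine Finset.sum_congr rfl fun i _ => ?_
  rw [map_mul, aeval_C, map_pow, aeval_X, Algebra.smul_def]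

/-- Coefficients of `∑_{j<N} C (c j) X^j`. [cite: HornJohnson2013, Thm. 3.2.4.2] -/
theorem coeff_sum_C_mul_X_pow (c : Fin N → F) (i : Fin N) :
    (∑ j : Fin N, C (c j) * X ^ (j : ℕ)).coeff i = c i := by
  rw [finsetSum_coeff]
  simp_rw [coeff_C_mul_X_pow]
  rw [Finset.sum_eq_single i]
  · simp
  · intro j _ hj
    rw [if_neg]
    exact fun h => hj (Fin.ext h.symm)
  · intro hi; exact absurd (Finset.mem_univ i) hi

/-- `∑_{j<N} C (c j) X^j = 0 ↔ c = 0`. [cite: HornJohnson2013, Thm. 3.2.4.2] -/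
theorem sum_C_mul_X_pow_eq_zero_iff (c : Fin N → F) :
    (∑ j : Fin N, C (c j) * X ^ (j : ℕ)) = 0 ↔ c = 0 := by
  constructor
  · intro h
    funext i
    have := coeff_sum_C_mul_X_pow c i
    rw [h, coeff_zero] at this
    exact this.symm
  · rintro rfl
    simp

variable {γ}

/-- **Uniqueness of coordinates**: for `γ` with separable characteristic polynomial the matrices `1, γ, …, γ^{N−1}` are linearly independent (★ `minpoly = charpoly`, degree `N`). [cite: HornJohnson2013, Thm. 3.2.4.2] -/
theorem eq_of_sum_smul_pow_eq (hγ : γ.charpoly.Separable) {c d : Fin N → F}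
    (h : ∑ i : Fin N, c i • γ ^ (i : ℕ) = ∑ i : Fin N, d i • γ ^ (i : ℕ)) : c = d := by
  have hmin := Literature.LinearAlgebra.Matrix.minpoly_eq_charpoly_of_charpoly_separable γ hγ
  have hsub : aeval γ (∑ i : Fin N, C ((c - d) i) * X ^ (i : ℕ)) = 0 := by
    rw [aeval_sum_C_mul_X_pow]
    simp only [Pi.sub_apply, sub_smul, Finset.sum_sub_distrib, h, sub_self]
  by_contra hne
  have hne' : (∑ i : Fin N, C ((c - d) i) * X ^ (i : ℕ)) ≠ 0 := by
    rw [Ne, sum_C_mul_X_pow_eq_zero_iff]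
    exact sub_ne_zero.2 hne
  have hdeg := minpoly.degree_le_of_ne_zero F γ hne' hsub
  rw [hmin] at hdeg
  have hlt := degree_sum_fin_lt fun i : Fin N => (c - d) i
  have hN : γ.charpoly.degree = N := by
    rw [Matrix.charpoly_degree_eq_dim, Fintype.card_fin]
  rw [hN] at hdeg
  exact absurd (lt_of_le_of_lt hdeg hlt) (lt_irrefl _)

/-- **Existence of coordinates**: every matrix commuting with a regular semisimple `γ` is `∑_{i<N} c_i γ^i` (★ `exists_eq_aeval_map_of_commute_of_charpoly_separable`). [cite: HornJohnson2013, Thm. 3.2.4.2] -/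
theorem exists_sum_smul_pow_eq_of_commute (hγ : γ.charpoly.Separable) {B : Matrix (Fin N) (Fin N) F} (hB : Commute γ B) :
    ∃ c : Fin N → F, ∑ i : Fin N, c i • γ ^ (i : ℕ) = B := by
  rcases Nat.eq_zero_or_pos N with hN0 | hNpos
  · subst hN0; exact ⟨fun _ => 0, Subsingleton.elim _ _⟩
  have hB' : Commute (γ.map (algebraMap F F)) B := by
    rw [Algebra.algebraMap_self, RingHom.coe_id, Matrix.map_id]; exact hB
  obtain ⟨p, hp, hpB⟩ := Literature.LinearAlgebra.Matrix.exists_eq_aeval_map_of_commute_of_charpoly_separable γ hγ B hB'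
  rw [Algebra.algebraMap_self, RingHom.coe_id, Matrix.map_id] at hpB
  refine ⟨fun i => p.coeff i, ?_⟩
  rw [hpB, ← aeval_sum_C_mul_X_pow]
  congr 1
  have hnat : p.natDegree < N := by
    rcases eq_or_ne p 0 with rfl | hp0
    · simp only [natDegree_zero]; exact hNpos
    · exact (natDegree_lt_iff_degree_lt hp0).2 hp
  conv_rhs => rw [p.as_sum_range_C_mul_X_pow' hnat]
  rw [Fin.sum_univ_eq_sum_range (fun i => C (p.coeff i) * X ^ i) N]

/-- **The eigen-coordinate at a root of `χ_γ` is multiplicative** on the commutant: if `(∑ c_i γ^i)(∑ d_i γ^i) = ∑ e_i γ^i` then `P_e(t) = P_c(t) P_d(t)` at every root `t` of `χ_γ` in any extension field (`χ_γ = minpoly ∣ P_c P_d − P_e`). [cite: HornJohnson2013, Thm. 3.2.4.2] -/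
theorem aeval_root_eq_mul_of_sum_smul_pow_mul (hγ : γ.charpoly.Separable) {c d e : Fin N → F}
    (h : (∑ i : Fin N, c i • γ ^ (i : ℕ)) * (∑ i : Fin N, d i • γ ^ (i : ℕ)) = ∑ i : Fin N, e i • γ ^ (i : ℕ))
    {L : Type*} [Field L] [Algebra F L] {t : L} (ht : aeval t γ.charpoly = 0) :
    aeval t (∑ i : Fin N, C (e i) * X ^ (i : ℕ)) =
      aeval t (∑ i : Fin N, C (c i) * X ^ (i : ℕ)) * aeval t (∑ i : Fin N, C (d i) * X ^ (i : ℕ)) := by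
  have hmin := Literature.LinearAlgebra.Matrix.minpoly_eq_charpoly_of_charpoly_separable γ hγ
  have hQ : aeval γ ((∑ i : Fin N, C (c i) * X ^ (i : ℕ)) * (∑ i : Fin N, C (d i) * X ^ (i : ℕ)) -
      ∑ i : Fin N, C (e i) * X ^ (i : ℕ)) = 0 := by
    rw [map_sub, map_mul, aeval_sum_C_mul_X_pow, aeval_sum_C_mul_X_pow, aeval_sum_C_mul_X_pow, h, sub_self]
  have hdvd := minpoly.dvd F γ hQ
  rw [hmin] at hdvd
  obtain ⟨R, hR⟩ := hdvd
  have h0 : aeval t ((∑ i : Fin N, C (c i) * X ^ (i : ℕ)) * (∑ i : Fin N, C (d i) * X ^ (i : ℕ)) -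
      ∑ i : Fin N, C (e i) * X ^ (i : ℕ)) = 0 := by
    rw [hR, map_mul, ht, zero_mul]
  rw [map_sub, map_mul, sub_eq_zero] at h0
  exact h0.symm

/-- Eigen-coordinates of powers: if `∑ (c n)_i γ^i = x^{n+1}` for all `n`, then `P_{c n}(t) = P_{c 0}(t)^{n+1}` at every root `t` of `χ_γ`. [cite: HornJohnson2013, Thm. 3.2.4.2] -/
theorem aeval_root_pow_succ (hγ : γ.charpoly.Separable) (x : Matrix (Fin N) (Fin N) F) (c : ℕ → Fin N → F)
    (hc : ∀ n, ∑ i : Fin N, c n i • γ ^ (i : ℕ) = x ^ (n + 1))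
    {L : Type*} [Field L] [Algebra F L] {t : L} (ht : aeval t γ.charpoly = 0) (n : ℕ) :
    aeval t (∑ i : Fin N, C (c n i) * X ^ (i : ℕ)) = (aeval t (∑ i : Fin N, C (c 0 i) * X ^ (i : ℕ))) ^ (n + 1) := by
  induction n with
  | zero => rw [zero_add, pow_one]
  | succ m ih =>
    have hmul : (∑ i : Fin N, c m i • γ ^ (i : ℕ)) * (∑ i : Fin N, c 0 i • γ ^ (i : ℕ)) = ∑ i : Fin N, c (m + 1) i • γ ^ (i : ℕ) := by
      rw [hc m, hc 0, hc (m + 1), zero_add, pow_one, ← pow_succ]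
    rw [aeval_root_eq_mul_of_sum_smul_pow_mul hγ hmul ht, ih, ← pow_succ]

end CoordAlgebra

/-! ## §2 The uniform coordinate bound over a complete ultrametric field -/

section Analytic

variable {F : Type*} [NontriviallyNormedField F] [CompleteSpace F] [IsUltrametricDist F] {N : ℕ}
  (γ : Matrix (Fin N) (Fin N) F)

/-- A non-archimedean function bounded by `B ≥ 0` on the summands is bounded by `B` on a finite sum. [cite: BoschGuntzerRemmert1984, 3.1.2/1] -/
theorem apply_sum_le_of_isNonarchimedean {L : Type*} [AddCommMonoid L] {f : L → ℝ} (hna : IsNonarchimedean f) (h0 : f 0 = 0)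
    {ι : Type*} (s : Finset ι) (g : ι → L) {B : ℝ} (hB : 0 ≤ B) (hg : ∀ i ∈ s, f (g i) ≤ B) :
    f (∑ i ∈ s, g i) ≤ B := by
  classical
  induction s using Finset.induction_on with
  | empty => rw [Finset.sum_empty, h0]; exact hB
  | insert a s has ih =>
    rw [Finset.sum_insert has]
    refine (hna _ _).trans (max_le (hg a (Finset.mem_insert_self a s)) (ih fun i hi => hg i (Finset.mem_insert_of_mem hi)))

/-- **The coordinate map `c ↦ ∑ c_i γ^i` is a closed embedding** `F^N → M_N(F)` (read in the Pi normed space) for `γ` regular semisimple over a complete field (Mathlib `LinearMap.isClosedEmbedding_of_injective`). [cite: BoschGuntzerRemmert1984, 3.1.2/1] -/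
theorem isClosedEmbedding_sum_smul_pow (hγ : γ.charpoly.Separable) :
    IsClosedEmbedding (fun c : Fin N → F => Matrix.of.symm (∑ i : Fin N, c i • γ ^ (i : ℕ))) := by
  let Φ : (Fin N → F) →ₗ[F] (Fin N → Fin N → F) :=
    { toFun := fun c => Matrix.of.symm (∑ i : Fin N, c i • γ ^ (i : ℕ))
      map_add' := fun c d => by
        ext a b
        simp only [Matrix.of_symm_apply, Pi.add_apply, add_smul, Finset.sum_add_distrib, Matrix.add_apply]
      map_smul' := fun r c => by
        ext a b
        simp only [Matrix.of_symm_apply, Pi.smul_apply, smul_eq_mul, RingHom.id_apply, mul_smul, ← Finset.smul_sum,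
          Matrix.smul_apply] }
  have hker : LinearMap.ker Φ = ⊥ := by
    rw [LinearMap.ker_eq_bot]
    intro c d hcd
    exact eq_of_sum_smul_pow_eq hγ (Matrix.of.symm.injective hcd)
  exact LinearMap.isClosedEmbedding_of_injective hker

omit [CompleteSpace F] [IsUltrametricDist F] in
/-- Reading a matrix as a function is continuous. [cite: HornJohnson2013, Thm. 3.2.4.2] -/
theorem continuous_matrix_of_symm : Continuous (fun x : Matrix (Fin N) (Fin N) F => Matrix.of.symm x) :=
  continuous_pi fun i => continuous_pi fun j => continuous_id.matrix_elem i j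

/-- **THE UNIFORM COORDINATE BOUND.**  For `γ ∈ M_N(F)` regular semisimple over a complete ultrametric field there is `R = R(γ) ≥ 0` such that for EVERY compact set `S ⊆ M_N(F)` closed under multiplication and commuting with `γ`, every `x = ∑ c_i γ^i ∈ S` has `‖c_i‖ ≤ R` for all `i` (power-boundedness ⇒ eigen-coordinates of spectral norm `≤ 1` at the `N` distinct roots of `χ_γ` in its splitting field ⇒ Lagrange interpolation). [cite: BoschGuntzerRemmert1984, 3.1.2/1] [cite: Tits1979, §3.9] -/
theorem exists_forall_norm_coord_le (hγ : γ.charpoly.Separable) :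
    ∃ R : ℝ, 0 ≤ R ∧ ∀ S : Set (Matrix (Fin N) (Fin N) F), IsCompact S → (∀ x ∈ S, ∀ y ∈ S, x * y ∈ S) → (∀ y ∈ S, Commute γ y) →
      ∀ x ∈ S, ∀ c : Fin N → F, ∑ i : Fin N, c i • γ ^ (i : ℕ) = x → ∀ j, ‖c j‖ ≤ R := by
  classical
  -- the splitting field, its spectral norm, the N distinct roots
  obtain ⟨s, hscard, hsroot⟩ : ∃ s : Finset γ.charpoly.SplittingField,
      s.card = N ∧ ∀ t ∈ s, aeval t γ.charpoly = 0 := by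
    refine ⟨(γ.charpoly.map (algebraMap F γ.charpoly.SplittingField)).roots.toFinset, ?_, fun t ht => ?_⟩
    · rw [Multiset.toFinset_card_of_nodup (nodup_roots hγ.map), ← (SplittingField.splits γ.charpoly).natDegree_eq_card_roots,
        natDegree_map, Matrix.charpoly_natDegree_eq_dim, Fintype.card_fin]
    · rw [Multiset.mem_toFinset, mem_roots', IsRoot.def, eval_map, ← aeval_def] at ht
      exact ht.2
  have hna := isNonarchimedean_spectralNorm (K := F) (L := γ.charpoly.SplittingField)
  have hf0 : spectralNorm F γ.charpoly.SplittingField 0 = 0 := spectralNorm_zero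
  have hfnn : ∀ y, 0 ≤ spectralNorm F γ.charpoly.SplittingField y := spectralNorm_nonneg
  refine ⟨∑ t ∈ s, ∑ j ∈ Finset.range N, spectralNorm F γ.charpoly.SplittingField ((Lagrange.basis s id t).coeff j),
    Finset.sum_nonneg fun t _ => Finset.sum_nonneg fun j _ => hfnn _, ?_⟩
  intro S hS hmul hcomm x hx c hcx j
  -- (a) coordinates of elements of `S` are uniformly bounded by some `M`
  have hT : IsCompact {d : Fin N → F | (∑ i : Fin N, d i • γ ^ (i : ℕ)) ∈ S} := by
    have h1 : IsCompact ((fun y : Matrix (Fin N) (Fin N) F => Matrix.of.symm y) '' S) := hS.image continuous_matrix_of_symm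
    have h2 := (isClosedEmbedding_sum_smul_pow γ hγ).isCompact_preimage h1
    have hset : {d : Fin N → F | (∑ i : Fin N, d i • γ ^ (i : ℕ)) ∈ S} =
        (fun c : Fin N → F => Matrix.of.symm (∑ i : Fin N, c i • γ ^ (i : ℕ))) ⁻¹'
          ((fun y : Matrix (Fin N) (Fin N) F => Matrix.of.symm y) '' S) := by
      ext d
      simp only [mem_setOf_eq, mem_preimage, Matrix.of.symm.injective.mem_set_image]
    rw [hset]; exact h2
  obtain ⟨M, hM⟩ : ∃ M, ∀ d ∈ {d : Fin N → F | (∑ i : Fin N, d i • γ ^ (i : ℕ)) ∈ S}, ∀ i, ‖d i‖ ≤ M := by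
    obtain ⟨M, hM⟩ := hT.isBounded.exists_norm_le
    exact ⟨M, fun d hd i => (norm_le_pi_norm d i).trans (hM d hd)⟩
  have hcT : c ∈ {d : Fin N → F | (∑ i : Fin N, d i • γ ^ (i : ℕ)) ∈ S} := by rw [mem_setOf_eq, hcx]; exact hx
  have hM0 : 0 ≤ M := (norm_nonneg (c j)).trans (hM c hcT j)
  -- (b) powers of `x` stay in `S`; their coordinates
  have hxpow : ∀ n : ℕ, x ^ (n + 1) ∈ S := by
    intro n
    induction n with
    | zero => rw [zero_add, pow_one]; exact hx
    | succ m ih => rw [pow_succ]; exact hmul _ ih _ hx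
  have hd : ∀ n : ℕ, ∃ d : Fin N → F, ∑ i : Fin N, d i • γ ^ (i : ℕ) = x ^ (n + 1) := fun n =>
    exists_sum_smul_pow_eq_of_commute hγ (hcomm _ (hxpow n))
  choose d hdspec using hd
  have hd0 : d 0 = c := eq_of_sum_smul_pow_eq hγ (by rw [hdspec 0, hcx, zero_add, pow_one])
  -- (c) at every root `t`, the eigen-coordinate of `x` has spectral norm ≤ 1
  have hev : ∀ t ∈ s, spectralNorm F γ.charpoly.SplittingField (aeval t (∑ i : Fin N, C (c i) * X ^ (i : ℕ))) ≤ 1 := by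
    intro t ht
    -- uniform bound on the eigen-coordinates of all elements of `S`
    have hbound : ∀ d' : Fin N → F, (∀ i, ‖d' i‖ ≤ M) →
        spectralNorm F γ.charpoly.SplittingField (aeval t (∑ i : Fin N, C (d' i) * X ^ (i : ℕ))) ≤
          M * max 1 (spectralNorm F γ.charpoly.SplittingField t) ^ N := by
      intro d' hd'
      rw [aeval_sum_C_mul_X_pow]
      refine apply_sum_le_of_isNonarchimedean hna hf0 _ _ (mul_nonneg hM0 (pow_nonneg (zero_le_one.trans (le_max_left _ _)) _))
        fun i _ => ?_
      rw [Algebra.smul_def]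
      refine (spectralNorm_mul (Algebra.IsAlgebraic.isAlgebraic _) (Algebra.IsAlgebraic.isAlgebraic _)).trans ?_
      rw [spectralNorm_extends]
      refine mul_le_mul (hd' i) ?_ (hfnn _) hM0
      rcases Nat.eq_zero_or_pos (i : ℕ) with hi0 | hipos
      · rw [hi0, pow_zero, spectralNorm_one]
        exact one_le_pow₀ (le_max_left _ _)
      · rw [isPowMul_spectralNorm t hipos]
        exact (pow_le_pow_left₀ (hfnn t) (le_max_right 1 _) _).trans
          (pow_le_pow_right₀ (le_max_left _ _) i.2.le)
    -- the eigen-coordinate of `x ^ (n+1)` is the `(n+1)`-st power of that of `x`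
    have hpow : ∀ n : ℕ, spectralNorm F γ.charpoly.SplittingField (aeval t (∑ i : Fin N, C (c i) * X ^ (i : ℕ))) ^ (n + 1) ≤
        M * max 1 (spectralNorm F γ.charpoly.SplittingField t) ^ N := by
      intro n
      rw [← isPowMul_spectralNorm _ (Nat.succ_pos n), ← hd0, ← aeval_root_pow_succ hγ x d hdspec (hsroot t ht) n]
      exact hbound (d n) (hM (d n) (by rw [mem_setOf_eq, hdspec n]; exact hxpow n))
    by_contra hgt
    rw [not_le] at hgt
    obtain ⟨n, hn⟩ := ((tendsto_pow_atTop_atTop_of_one_lt hgt).eventually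
      (eventually_gt_atTop (M * max 1 (spectralNorm F γ.charpoly.SplittingField t) ^ N))).exists
    have h1 := hpow n
    have h2 : spectralNorm F γ.charpoly.SplittingField (aeval t (∑ i : Fin N, C (c i) * X ^ (i : ℕ))) ^ n ≤
        spectralNorm F γ.charpoly.SplittingField (aeval t (∑ i : Fin N, C (c i) * X ^ (i : ℕ))) ^ (n + 1) :=
      pow_le_pow_right₀ hgt.le (Nat.le_succ n)
    linarith
  -- (d) Lagrange interpolation at the `N` roots recovers the coefficients
  set q : (γ.charpoly.SplittingField)[X] := (∑ i : Fin N, C (c i) * X ^ (i : ℕ)).map (algebraMap F γ.charpoly.SplittingField)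
    with hq
  have hqdeg : q.degree < s.card := by
    rw [hq, degree_map, hscard]
    exact degree_sum_fin_lt c
  have hcoeff : q.coeff j = ∑ t ∈ s, q.eval t * (Lagrange.basis s id t).coeff j := by
    have h := Lagrange.eq_interpolate (s := s) (v := id) (f := q) (fun _ _ _ _ h => h) hqdeg
    conv_lhs => rw [h]
    rw [Lagrange.interpolate_apply, finsetSum_coeff]
    refine Finset.sum_congr rfl fun t _ => ?_
    rw [coeff_C_mul, id]
  have hqj : q.coeff j = algebraMap F γ.charpoly.SplittingField (c j) := by
    rw [hq, coeff_map, coeff_sum_C_mul_X_pow]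
  have hqeval : ∀ t, q.eval t = aeval t (∑ i : Fin N, C (c i) * X ^ (i : ℕ)) := fun t => by
    rw [hq, ← eval₂_eq_eval_map, aeval_def]
  -- (e) the bound
  rw [← spectralNorm_extends (L := γ.charpoly.SplittingField) (c j), ← hqj, hcoeff]
  refine apply_sum_le_of_isNonarchimedean hna hf0 _ _
    (Finset.sum_nonneg fun t _ => Finset.sum_nonneg fun j _ => hfnn _) fun t ht => ?_
  refine (spectralNorm_mul (Algebra.IsAlgebraic.isAlgebraic _) (Algebra.IsAlgebraic.isAlgebraic _)).trans ?_
  rw [hqeval]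
  refine (mul_le_of_le_one_left (hfnn _) (hev t ht)).trans ?_
  have hjN : (j : ℕ) ∈ Finset.range N := Finset.mem_range.2 j.2
  exact (Finset.single_le_sum (f := fun j => spectralNorm F γ.charpoly.SplittingField ((Lagrange.basis s id t).coeff j))
    (fun j _ => hfnn _) hjN).trans
    (Finset.single_le_sum (f := fun t => ∑ j ∈ Finset.range N, spectralNorm F γ.charpoly.SplittingField ((Lagrange.basis s id t).coeff j))
      (fun t _ => Finset.sum_nonneg fun j _ => hfnn _) ht)

end Analytic

/-! ## §3 `GL_N(F)`: the compact core of the centraliser lies in one compact set; compactness given closedness -/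

section GLCore

variable {F : Type*} [NontriviallyNormedField F] [CompleteSpace F] [IsUltrametricDist F] [ProperSpace F] {N : ℕ}
  (γ : GL (Fin N) F)

/-- **The compact core of `Z_{GL_N(F)}(γ)` lies in ONE compact set of matrices** (`γ` regular semisimple; `F` complete, ultrametric, proper): every compact subgroup of the centraliser is a compact multiplicatively closed set commuting with `γ`, so `exists_forall_norm_coord_le` puts its elements' coordinates in the box `‖c_i‖ ≤ R`, whose image under the coordinate map is compact. [cite: Tits1979, §3.9] [cite: PlatonovRapinchuk1994, §3.3] -/
theorem exists_isCompact_forall_mem_compactCore_centralizer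
    (hγ : ((γ : Matrix (Fin N) (Fin N) F).charpoly).Separable) :
    ∃ C : Set (Matrix (Fin N) (Fin N) F), IsCompact C ∧
      ∀ z ∈ compactCore (Subgroup.centralizer ({γ} : Set (GL (Fin N) F))),
        ((z : GL (Fin N) F) : Matrix (Fin N) (Fin N) F) ∈ C := by
  obtain ⟨R, hR0, hR⟩ := exists_forall_norm_coord_le (γ : Matrix (Fin N) (Fin N) F) hγ
  refine ⟨(fun c : Fin N → F => ∑ i : Fin N, c i • (γ : Matrix (Fin N) (Fin N) F) ^ (i : ℕ)) ''
      Set.pi Set.univ (fun _ : Fin N => Metric.closedBall (0 : F) R), ?_, fun z hz => ?_⟩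
  · refine (isCompact_univ_pi fun _ => isCompact_closedBall (0 : F) R).image ?_
    exact continuous_finsetSum _ fun i _ => (continuous_apply i).smul continuous_const
  · obtain ⟨K, hK, hzK⟩ := (mem_compactCore_iff z).1 hz
    -- the compact, multiplicatively closed set of matrices `S = val(K)`
    set S : Set (Matrix (Fin N) (Fin N) F) :=
      (fun u : Subgroup.centralizer ({γ} : Set (GL (Fin N) F)) => ((u : GL (Fin N) F) : Matrix (Fin N) (Fin N) F)) '' (K : Set _)
      with hS
    have hSc : IsCompact S := hK.image (Units.continuous_val.comp continuous_subtype_val)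
    have hSmul : ∀ x ∈ S, ∀ y ∈ S, x * y ∈ S := by
      rintro _ ⟨u, hu, rfl⟩ _ ⟨u', hu', rfl⟩
      exact ⟨u * u', K.mul_mem hu hu', by simp only [Subgroup.coe_mul, Units.val_mul]⟩
    have hScomm : ∀ y ∈ S, Commute (γ : Matrix (Fin N) (Fin N) F) y := by
      rintro _ ⟨u, -, rfl⟩
      have hu := u.2
      rw [Subgroup.mem_centralizer_singleton_iff] at hu
      have h := congrArg (fun g : GL (Fin N) F => (g : Matrix (Fin N) (Fin N) F)) hu
      simp only [Units.val_mul] at h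
      exact h.symm
    have hzS : ((z : GL (Fin N) F) : Matrix (Fin N) (Fin N) F) ∈ S := ⟨z, hzK, rfl⟩
    obtain ⟨c, hc⟩ := exists_sum_smul_pow_eq_of_commute hγ (hScomm _ hzS)
    refine ⟨c, Set.mem_univ_pi.2 fun j => ?_, hc⟩
    rw [Metric.mem_closedBall, dist_zero_right]
    exact hR S hSc hSmul hScomm _ hzS c hc j

/-- **The compact core of the centraliser of a regular semisimple `γ ∈ GL_N(F)` is COMPACT once it is closed** (it is inverse-closed, so `z ↦ (↑z, ↑z⁻¹)` lands in the compact `C × Cᵒᵖ`, and `Units.embedProduct`, `Subtype.val` are closed embeddings) — closedness is FILE B's (one compact open subgroup of the commutative `Z(γ)`). [cite: Tits1979, §3.9] [cite: PlatonovRapinchuk1994, §3.3] -/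
theorem isCompact_compactCore_centralizer_of_isClosed
    (hγ : ((γ : Matrix (Fin N) (Fin N) F).charpoly).Separable)
    (hcl : IsClosed (compactCore (Subgroup.centralizer ({γ} : Set (GL (Fin N) F))))) :
    IsCompact (compactCore (Subgroup.centralizer ({γ} : Set (GL (Fin N) F)))) := by
  obtain ⟨C, hC, hmem⟩ := exists_isCompact_forall_mem_compactCore_centralizer γ hγ
  -- the compact set `{g | g ∈ C, g⁻¹ ∈ C}` of `GL_N(F)`, pulled back to the centraliser
  have hGL : IsCompact ((Units.embedProduct (Matrix (Fin N) (Fin N) F)) ⁻¹' (C ×ˢ (MulOpposite.op '' C))) :=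
    Units.isClosedEmbedding_embedProduct.isCompact_preimage (hC.prod (hC.image MulOpposite.continuous_op))
  have hZ : IsCompact ((Subtype.val : Subgroup.centralizer ({γ} : Set (GL (Fin N) F)) → GL (Fin N) F) ⁻¹'
      ((Units.embedProduct (Matrix (Fin N) (Fin N) F)) ⁻¹' (C ×ˢ (MulOpposite.op '' C)))) :=
    (Set.isClosed_centralizer _).isClosedEmbedding_subtypeVal.isCompact_preimage hGL
  refine hZ.of_isClosed_subset hcl fun z hz => ?_
  rw [mem_preimage, mem_preimage, Units.embedProduct_apply, mem_prod]
  refine ⟨hmem z hz, ⟨((z⁻¹ : Subgroup.centralizer ({γ} : Set (GL (Fin N) F))) : GL (Fin N) F), hmem _ ?_, rfl⟩⟩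
  obtain ⟨K, hK, hzK⟩ := (mem_compactCore_iff z).1 hz
  exact (mem_compactCore_iff _).2 ⟨K, hK, K.inv_mem hzK⟩

end GLCore

end Literature.NumberTheory.Automorphic

end
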